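import Literature.NumberTheory.EllipticCurves.CongruenceNumberLevelBoundExplicitProofs
import HarnessLib

/-!
# The modular method's `R log R` bound for ALL `abc` triples from modularity and Mazur–Kenku (proofs)

Topic `Literature/NumberTheory/EllipticCurves` (family `abc`, LADDER-ABC A1, the *modular method*;
cell abc-stewartyu, seat lit-abc-pasten g5). Theorems only — NO new statement, NO new named fact
(D-0026). Companion of `CongruenceNumberLevelBoundExplicitProofs.lean` (Murty–Pasten 2013, Thm 4.3
explicit DISCHARGED; Thm 7.1 `log|Δ_E| < 1.2 N log N + 148` for EVERY `E/ℚ` from modularity and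
Mazur–Kenku).

* `bakerShapeBound_one_one_of_discriminant_bound` — any explicit bound
  `log|Δ_min(E)| < A · N_E log N_E + B` valid for ALL `E/ℚ` gives
  `Literature.Barriers.ABC.BakerShapeBound 1 1` with `κ = 2 + 5632 A + B/2` (Frey-curve translation
  of Murty–Pasten §8 over the tree's bookkeeping `N ∣ 2¹⁰ rad(abc)`, `(abc)² ∣ 2⁸ Δ_min`,
  `exists_frey_model_sq_dvd`; threshold-free companion of `epsShapeBound_one_of_discriminant_levelBound`).
* `bakerShapeBound_one_one_of_modularity_mazurKenku` — **`log c ≤ κ · rad(abc) · log rad(abc)` for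
  ALL `abc` triples** (`κ = 6834.4`) from the TWO named facts {`nonempty_modularParametrizationData`,
  `PastenShimura2024_minimalDegree_le_163_mul`}: the Murty–Pasten/Pasten trust path of rung A1.P now
  reaches the exponential class `BakerShapeBound 1 1` itself (all triples, explicit `κ`), not only the
  `ε`-shape `EpsShapeBound 1` with a threshold (`epsShapeBound_one_of_modularity_mazurKenku`); compare
  the von Känel–Matschke road `bakerShapeBound_one_one_of_modularity_of_prop_10_8_i`
  (modularity + vKM Prop. 10.8 (i)).

WHAT THIS IS NOT: Murty–Pasten's printed constants `4.8 R log R + 13 R + 25` (Thm 1.2) are not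
asserted (their proof uses Diamond–Kramer's conductor exponent `2⁴` at `2`; the tree proves `2¹⁰`);
no claim on `abc`; `θ₀ = 1` material, below the REACHED `EpsShapeBound (2/3)`.

## References

* [MurtyPasten2013] M. R. Murty, H. Pasten, J. Number Theory 133 (2013) 3739–3754: Thm 1.2, Thm 7.1,
  §8 (pp. 3752–3753).
* [PastenShimura2024] H. Pasten, J. Number Theory 254 (2024) = arXiv:1705.09251v4, §3 p. 13
  (Frey–Hellegouarch curves, (3.1)–(3.2)).
-/

noncomputable section

open scoped MatrixGroups ModularForm

open WeierstrassCurve CongruenceSubgroup UpperHalfPlane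

namespace Literature.NumberTheory.EllipticCurves

open ModularForms Pasten2024 DiophantineGeometry

/-! ### The modular method's `R log R` shape for ALL `abc` triples from modularity and Mazur–Kenku -/

section BakerShape

open UniqueFactorizationMonoid IsDedekindDomain

/-- **`BakerShapeBound 1 1` from an explicit bound `log|Δ_min(E)| < A · N_E log N_E + B` valid for
ALL `E/ℚ`** (PROVED; the Frey-curve translation of Murty–Pasten §8 with the constants as parameters,
threshold-free companion of `epsShapeBound_one_of_discriminant_levelBound`): `log c ≤
(2 + 5632 A + B/2) · rad(abc) · log rad(abc)` for every `abc` triple. Proof: for the Frey model `W₀` of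
`exists_frey_model_sq_dvd`, `2 log c ≤ 8 log 2 + log|Δ_min(W₀)|` and `N_{W₀} ≤ 2¹⁰ rad(abc)`, so
`N log N ≤ 1024 R (10 log 2 + log R) ≤ 11264 · R log R` and `8 log 2 ≤ 4 R log R`, `B ≤ B · R log R`
(`R log R ≥ 2 log 2 > 1`). [cite: MurtyPasten2013, §8 (proof of Thm 1.2)] [cite: PastenShimura2024, §3 (Frey–Hellegouarch curves)] -/
theorem bakerShapeBound_one_one_of_discriminant_bound {A B : ℝ} (hA : 0 ≤ A) (hB : 0 ≤ B)
    (h : ∀ (W : WeierstrassCurve ℚ) [W.IsElliptic],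
      Real.log (W.minimalDiscriminantNorm ℤ : ℝ) <
        A * (W.conductorNorm ℤ : ℝ) * Real.log (W.conductorNorm ℤ) + B) :
    Literature.Barriers.ABC.BakerShapeBound 1 1 := by
  refine ⟨2 + 5632 * A + B / 2, fun a b c ht => ?_⟩
  have ht' := ht
  obtain ⟨ha, hb, habc, hcop⟩ := ht'
  have hc : 0 < c := by omega
  -- the Frey model and the discriminant bound at its conductor
  obtain ⟨W₀, hE, hN, hΔ⟩ := exists_frey_model_sq_dvd ht
  haveI := hE
  have hΔpos : 0 < (W₀.baseChange ℚ).minimalDiscriminantNorm ℤ := minimalDiscriminantNorm_pos_holds _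
  have hNpos : 0 < (W₀.baseChange ℚ).conductorNorm ℤ := conductorNorm_pos_holds _
  have hbound := h (W₀.baseChange ℚ)
  -- real-number bookkeeping
  have hradpos : 0 < rad a b c := by rw [rad_def]; exact Nat.radical_pos _
  have hR2 : (2 : ℝ) ≤ (rad a b c : ℝ) := by exact_mod_cast IsABCTriple.two_le_rad ht
  have hN1 : (1 : ℝ) ≤ ((W₀.baseChange ℚ).conductorNorm ℤ : ℝ) := by exact_mod_cast hNpos
  have hD0 : (0 : ℝ) < ((W₀.baseChange ℚ).minimalDiscriminantNorm ℤ : ℝ) := by exact_mod_cast hΔpos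
  have hNR : ((W₀.baseChange ℚ).conductorNorm ℤ : ℝ) ≤ 1024 * (rad a b c : ℝ) := by
    have := Nat.le_of_dvd (mul_pos (by positivity) hradpos) hN
    exact_mod_cast this
  have hc2 : (c : ℝ) ^ 2 ≤ 2 ^ 8 * ((W₀.baseChange ℚ).minimalDiscriminantNorm ℤ : ℝ) := by
    have h1 : c ≤ a * b * c := Nat.le_mul_of_pos_left c (by positivity)
    have h2 : (a * b * c) ^ 2 ≤ 2 ^ 8 * (W₀.baseChange ℚ).minimalDiscriminantNorm ℤ :=
      Nat.le_of_dvd (by positivity) hΔ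
    have h3 : c ^ 2 ≤ 2 ^ 8 * (W₀.baseChange ℚ).minimalDiscriminantNorm ℤ :=
      (Nat.pow_le_pow_left h1 2).trans h2
    exact_mod_cast h3
  set N : ℝ := ((W₀.baseChange ℚ).conductorNorm ℤ : ℝ) with hNdef
  set D : ℝ := ((W₀.baseChange ℚ).minimalDiscriminantNorm ℤ : ℝ) with hDdef
  set R : ℝ := (rad a b c : ℝ) with hRdef
  have hl2 := Real.log_two_lt_d9
  have hl2' := Real.log_two_gt_d9
  have hlogc : 2 * Real.log c ≤ 8 * Real.log 2 + Real.log D := by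
    have h1 : Real.log ((c : ℝ) ^ 2) ≤ Real.log (2 ^ 8 * D) :=
      Real.log_le_log (by positivity) hc2
    rw [Real.log_pow, Real.log_mul (by positivity) hD0.ne', Real.log_pow] at h1
    push_cast at h1
    linarith
  have hL : Real.log 2 ≤ Real.log R := Real.log_le_log (by norm_num) hR2
  have hlogN0 : 0 ≤ Real.log N := Real.log_nonneg hN1
  have hlogN : Real.log N ≤ 10 * Real.log 2 + Real.log R := by
    have h1 : Real.log N ≤ Real.log (1024 * R) := Real.log_le_log (by linarith) hNR
    rw [Real.log_mul (by norm_num) (by linarith), show (1024 : ℝ) = 2 ^ 10 by norm_num,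
      Real.log_pow] at h1
    push_cast at h1
    linarith
  have hNlogN : N * Real.log N ≤ 1024 * R * (10 * Real.log 2 + Real.log R) :=
    mul_le_mul hNR hlogN hlogN0 (by positivity)
  -- with `X = R log R ≥ 2 log 2 > 1`: `log D ≤ 11264 A X + B X`, `8 log 2 ≤ 4 X`
  set X : ℝ := R * Real.log R with hXdef
  have hR0 : (0 : ℝ) < R := by linarith
  have hX : 2 * Real.log 2 ≤ X := by rw [hXdef]; exact mul_le_mul hR2 hL (by linarith) hR0.le
  have hX1 : 1 ≤ X := by linarith
  have hl2R : Real.log 2 * R ≤ X := by rw [hXdef]; nlinarith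
  have hD1 : Real.log D ≤ A * (1024 * R * (10 * Real.log 2 + Real.log R)) + B := by
    have h1 : A * (N * Real.log N) ≤ A * (1024 * R * (10 * Real.log 2 + Real.log R)) :=
      mul_le_mul_of_nonneg_left hNlogN hA
    have h2 : A * N * Real.log N = A * (N * Real.log N) := by ring
    linarith [hbound.le]
  have hD2 : A * (1024 * R * (10 * Real.log 2 + Real.log R)) ≤ 11264 * A * X := by
    have : 1024 * R * (10 * Real.log 2 + Real.log R) = 10240 * (Real.log 2 * R) + 1024 * X := by
      rw [hXdef]; ring
    rw [this]
    nlinarith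
  have hBX : B ≤ B * X := by nlinarith
  have hmain : Real.log c ≤ (2 + 5632 * A + B / 2) * X := by nlinarith
  rw [Real.rpow_one, pow_one]
  calc Real.log c ≤ (2 + 5632 * A + B / 2) * (R * Real.log R) := hmain
    _ = (2 + 5632 * A + B / 2) * R * Real.log R := by ring

/-- **The `R log R` rung of the modular method for ALL `abc` triples from TWO named facts**
(`Literature.Barriers.ABC.BakerShapeBound 1 1`: `∃ κ, ∀ abc triples, log c ≤ κ · rad · log rad`; here
`κ = 2 + 5632 · 1.2 + 74`): modularity with an integral Manin constant
(`nonempty_modularParametrizationData`) and Mazur–Kenku (`PastenShimura2024_minimalDegree_le_163_mul`),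
through Murty–Pasten's explicit Thm 7.1 (`log_minimalDiscriminant_lt_148_of_modularity_mazurKenku`,
valid at EVERY conductor — no threshold, unlike the asymptotic road of
`epsShapeBound_one_of_modularity_mazurKenku`) and `bakerShapeBound_one_one_of_discriminant_bound`.
This is the shape of Murty–Pasten's Thm 1.2 (`log max{|A|,|B|,|C|} < 4.8 R log R + 13 R + 25`) with
the constants the tree's Frey bookkeeping (`N ∣ 2¹⁰ rad`, `(abc)² ∣ 2⁸ Δ_min`) supports; the printed
`4.8` needs Diamond–Kramer's exponent `2⁴` at `2` and is not asserted. Compare the von Känel–Matschke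
road `bakerShapeBound_one_one_of_modularity_of_prop_10_8_i` (modularity + vKM Prop. 10.8 (i)).
[cite: MurtyPasten2013, Thm 1.2 and §8] [cite: PastenShimura2024, §3] -/
theorem bakerShapeBound_one_one_of_modularity_mazurKenku (hmod : nonempty_modularParametrizationData)
    (h163 : PastenShimura2024_minimalDegree_le_163_mul) :
    Literature.Barriers.ABC.BakerShapeBound 1 1 :=
  bakerShapeBound_one_one_of_discriminant_bound (A := 1.2) (B := 148) (by norm_num) (by norm_num)
    fun W _ => MurtyPasten.log_minimalDiscriminant_lt_148_of_modularity_mazurKenku hmod h163 W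

end BakerShape

end Literature.NumberTheory.EllipticCurves

end
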